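import Summits.QuantumFields.YangMills.Theorems.LangevinControlUVOSLegsFromFemtoAndGapStubCollar6
import Literature.MathematicalPhysics.QuantumLattice.LatticeGaugeDLRGibbsProofs
import Literature.MathematicalPhysics.QuantumFieldTheory.LatticeGaugeShenZhuZhuProofs
import Literature.Probability.LatticeModels.GibbsSpecificationDLRProofs
import HarnessLib

/-!
# The `ℤ⁴`-DLR collar: the plane-resolved frozen-boundary law `FBL6` gives the E0′ ceilings for EVERY
# infinite-volume DLR state (no torus, no volume)

HONEST FRAMING (R136 (i) «parallel continuum programme», seat `ym-infvol-p1`, pre-birth helper; bears on the spine route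
`BalabanLadder`: leaf `UV` = stmt-QuantumFields-19351 and crux `UVSeamRec` = stmt-QuantumFields-20043, whose honest E0′
residual is typed in kernel form `UV → ∀ r, ∃ a c, 0 < c ∧ (∀ᶠ β, a β ≤ c·uRec β) ∧ FBL6 SU(2) r a` by the 20043 lead's
card).  Pure soft analysis, kernel-checked; NOTHING about Bałaban's renormalisation group, the continuum limit,
uniqueness of the Gibbs state or a mass gap is asserted.  The frozen-boundary law `DlrCollarTransfer.FBL6 G r a` is a
HYPOTHESIS (E0′ proper, unprinted — barrier `UVStabilityNonUniqueness`).  Existence half only; not a gap, not Clay.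

CONTENT.  The tree's collar `stub_collar6 : FBL6 G r a → MomentBounds6 G r a`
(Theorems/LangevinControlUVOSLegsFromFemtoAndGapStubCollar6) runs on the PERIODIC states of odd tori, through the torus
DLR identity with a far factor (`abs_integral_prod_sub_mean_le`, Literature/…/LatticeGaugeDLRFarFactorProofs).  The
mechanism — conditional independence of sup-separated cubes given their exteriors, plus `FBL6` pinning each kernel mean
to within `C₁/d⁴` of a reference value — is a statement about the LOCAL DLR kernels `ymSpecification r.ρ β Λ η` and sees
no volume.  This file runs it for an arbitrary DLR state on `ℤ⁴`:

* §1 `integral_mul_ymSpecification_of_dependsOn_compl` — pull-out: a factor depending only on the links OFF `Λ` comes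
  out of the kernel `γ_Λ(· | η)` as its value at `η` (the kernel glues `η` outside `Λ`, tree `integral_ymSpecification`).
* §2 `integral_mul_eq_integral_kernelMean_mul` — one DLR step in a Gibbs state: `∫ F·H dμ = ∫ (γ_Λ F)·H dμ` for `H`
  depending only on `Λᶜ` (tree `IsGibbsMeasure.integral_integral_eq` + §1; Georgii (1.28), Friedli–Velenik (6.34)).
* §3 `abs_integral_prod_sub_mean_le_of_isGibbsMeasure` — THE GIBBS COLLAR: bounded continuous cylinder observables
  `A₁ … Aₙ` on link sets `Λ₁ … Λₙ` with `Λⱼ ∪ ∂Λⱼ` disjoint from `Λᵢ` (`i ≠ j`, `∂Λ` = links of plaquettes touching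
  `Λ`), every kernel mean `γ_{Λᵢ} Aᵢ (η)` within `ε` of a common value: `|∫ ∏ᵢ (Aᵢ − ∫Aᵢ dμ) dμ| ≤ (2ε)ⁿ` for EVERY
  `μ ∈ 𝒢(ymSpecification)` — one DLR step per site, the already-conditioned factors `γ_{Λᵢ}Aᵢ − ∫Aᵢ` being cylinder on
  `Λᵢ ∪ ∂Λᵢ` (quasilocality, tree `dependsOn_integral_ymSpecification`) hence part of the far factor of the later steps.
* §4 `cubeEdges_far` (the radius-`R+1` cubes around `2R+4`-sup-separated sites of `ℤ⁴` satisfy §3's disjointness) and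
  **`dlrCeilings_of_fbl6`** — `FBL6 G r a ⟹ ∃ C β₄ ℓ₄, 0 < ℓ₄ ∧ 0 ≤ C ∧ ∀ β ≥ β₄, ∀ μ ∈ ymGibbsMeasures r.ρ β`, every
  plane string at pairwise `2R+4`-sup-separated sites, `1 ≤ R`, `R·a β ≤ ℓ₄`:
  `|∫ ∏ᵢ (plane qᵢ xᵢ − ∫ plane qᵢ xᵢ dμ) dμ| ≤ (C/R⁴)ⁿ` with `C = 2C₁`, `β₄ = β₁`, `ℓ₄ = ℓ₁/5` — VERBATIM the body of
  the named form `InfiniteVolume.MomentBounds6DLR G r a` (Theorems/BalabanLadderInfVolCeilingsDefs, seat p1), and a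
  fortiori (torus limit states are DLR, Georgii Thm. 4.17) of `MomentBounds6IV` / `MomentBounds6TL`.

References: H.-O. Georgii, Gibbs Measures and Phase Transitions (2011) Def. 1.23, Rem. 1.24, (2.15), Thm. 4.17;
S. Friedli, Y. Velenik, Statistical Mechanics of Lattice Systems (2017) Lemma 6.7, (6.34), Lemma 6.28; E. Seiler,
LNP 159 (1982) Ch. 2.
-/

set_option autoImplicit false

noncomputable section

open MeasureTheory Filter Topology Finset
open scoped BigOperators
open Literature.MathematicalPhysics.QuantumFieldTheory hiding ZdEdge
open Literature.MathematicalPhysics.QuantumLattice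
open Literature.Probability.LatticeModels
open Summit.QuantumFields.YangMills.Cruxes.OSLegsFromFemtoAndGap.DlrCollarTransfer

namespace Summit.QuantumFields.YangMills.Theorems.InfiniteVolume

/-! ## §1 Pull-out of exterior factors from the lattice Yang–Mills kernels -/

section Kernel

variable {d N : ℕ} {G : Type} [Group G] [TopologicalSpace G] [IsTopologicalGroup G] [CompactSpace G]
  [MeasurableSpace G] [BorelSpace G] [SecondCountableTopology G] (ρ : G →* Matrix (Fin N) (Fin N) ℂ)

/-- **Pull-out**: a factor `H` depending only on the links off `Λ` comes out of the kernel `γ_Λ(· | η)` as `H η`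
(the kernel integrates `F (ζ η_{Λᶜ})` over the links `ζ` of `Λ`, tree `integral_ymSpecification`). [folklore] -/
theorem integral_mul_ymSpecification_of_dependsOn_compl (hρ : Continuous ρ) (β : ℝ) (Λ : Finset (ZdEdge d))
    {F H : LGConfig d G → ℝ} (hF : Measurable F) (hH : Measurable H)
    (hHdep : DependsOn H ((↑Λ : Set (ZdEdge d))ᶜ)) (η : LGConfig d G) :
    ∫ U, F U * H U ∂(ymSpecification ρ β Λ η) = H η * ∫ U, F U ∂(ymSpecification ρ β Λ η) := by
  have hglue : ∀ ζ : ↥Λ → G, H (glueWith Λ ζ η) = H η := fun ζ =>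
    hHdep fun e he => glueWith_apply_not_mem Λ ζ η (fun h => he (Finset.mem_coe.2 h))
  rw [integral_ymSpecification ρ hρ β Λ (F := fun U => F U * H U) (hF.mul hH), integral_ymSpecification ρ hρ β Λ hF]
  simp only [hglue]
  have e1 : (fun ζ : ↥Λ → G => F (glueWith Λ ζ η) * H η *
      Real.exp (-β * wilsonBoundaryAction ρ Λ (glueWith Λ ζ η))) =
      fun ζ => H η * (F (glueWith Λ ζ η) * Real.exp (-β * wilsonBoundaryAction ρ Λ (glueWith Λ ζ η))) := by
    funext ζ; ring
  rw [e1, integral_const_mul, mul_div_assoc]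

end Kernel

/-! ## §2 One DLR step in an infinite-volume Gibbs state -/

section Step

variable {d N : ℕ} {G : Type} [Group G] [TopologicalSpace G] [IsTopologicalGroup G] [CompactSpace G]
  [MeasurableSpace G] [BorelSpace G] [SecondCountableTopology G] (ρ : G →* Matrix (Fin N) (Fin N) ℂ)

/-- **One DLR step**: for a DLR state `μ` of `ymSpecification ρ β`, bounded measurable `F` and a bounded measurable
`H` depending only on the links off `Λ`, `∫ F·H dμ = ∫ (γ_Λ F)(η) · H(η) dμ(η)` (Georgii Rem. 1.24 / (1.28): the DLR
equation for the observable `F·H`, tree `IsGibbsMeasure.integral_integral_eq`, and the pull-out §1). [folklore] -/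
theorem integral_mul_eq_integral_kernelMean_mul (hρ : Continuous ρ) {β : ℝ}
    (hγ : IsSpecification (ymSpecification (d := d) ρ β)) {μ : Measure (LGConfig d G)}
    (hμ : IsGibbsMeasure (ymSpecification (d := d) ρ β) μ) (Λ : Finset (ZdEdge d))
    {F H : LGConfig d G → ℝ} (hF : Measurable F) {CF : ℝ} (hFb : ∀ U, |F U| ≤ CF) (hH : Measurable H) {CH : ℝ}
    (hHb : ∀ U, |H U| ≤ CH) (hHdep : DependsOn H ((↑Λ : Set (ZdEdge d))ᶜ)) :
    ∫ U, F U * H U ∂μ = ∫ η, (∫ U, F U ∂(ymSpecification ρ β Λ η)) * H η ∂μ := by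
  haveI := hμ.isProbabilityMeasure
  have hint : Integrable (fun U => F U * H U) μ :=
    integrable_of_abs_le (hF.mul hH) (C := CF * CH) fun U => by
      rw [abs_mul]
      exact mul_le_mul (hFb U) (hHb U) (abs_nonneg _) ((abs_nonneg _).trans (hFb U))
  rw [← hμ.integral_integral_eq hγ Λ hint]
  refine integral_congr_ae (ae_of_all _ fun η => ?_)
  change ∫ U, F U * H U ∂(ymSpecification ρ β Λ η) = _
  rw [integral_mul_ymSpecification_of_dependsOn_compl ρ hρ β Λ hF hH hHdep η, mul_comm]

end Step

/-! ## §3 The Gibbs collar: centred moments of separated cylinder observables in a DLR state -/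

section Collar

variable {d N : ℕ} {G : Type} [Group G] [TopologicalSpace G] [IsTopologicalGroup G] [CompactSpace G]
  [MeasurableSpace G] [BorelSpace G] (ρ : G →* Matrix (Fin N) (Fin N) ℂ)

omit [Group G] [TopologicalSpace G] [IsTopologicalGroup G] [CompactSpace G] [MeasurableSpace G] [BorelSpace G] in
/-- A finite product of observables each depending only on a set `T` depends only on `T`. [folklore] -/
theorem dependsOn_finset_prod {ι : Type*} (s : Finset ι) {f : ι → LGConfig d G → ℝ} {T : Set (ZdEdge d)}
    (h : ∀ i ∈ s, DependsOn (f i) T) : DependsOn (fun U => ∏ i ∈ s, f i U) T :=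
  fun _ _ hUV => Finset.prod_congr rfl fun i hi => h i hi hUV

/-- **THE GIBBS COLLAR.**  Let `μ` be a DLR state of the lattice Yang–Mills specification at coupling `β` (`T₂`, second
countable compact `G`, continuous `ρ`).  Let `A₁, …, Aₙ` be continuous (hence bounded) cylinder observables with
`Aᵢ` supported on the link set `Λᵢ`, and suppose the volumes are mutually far: for `i ≠ j` the links of `Λⱼ` and of
the plaquettes touching `Λⱼ` avoid `Λᵢ`.  If every kernel mean `γ_{Λᵢ} Aᵢ (η)` is within `ε` of a common value `cᵢ`
uniformly in the exterior `η`, then `|∫ ∏ᵢ (Aᵢ − ∫ Aᵢ dμ) dμ| ≤ (2ε)ⁿ`.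
Proof: `|∫Aᵢ dμ − cᵢ| ≤ ε` (DLR), so `hᵢ := γ_{Λᵢ}Aᵢ − ∫Aᵢ dμ` has `|hᵢ| ≤ 2ε` and is a cylinder observable on
`Λᵢ ∪ ∂Λᵢ` (quasilocality); replacing the factors `Aᵢ − ∫Aᵢ dμ` by `hᵢ` one at a time does not change the integral
(§2: the other factors depend only on `Λᵢᶜ`), and `|∫ ∏ hᵢ dμ| ≤ (2ε)ⁿ`. (Georgii Thm. 4.17's mechanism; Seiler Ch. 2.)
[folklore] -/
theorem abs_integral_prod_sub_mean_le_of_isGibbsMeasure [T2Space G] [SecondCountableTopology G]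
    (hρ : Continuous ρ) {β : ℝ} {μ : Measure (LGConfig d G)} (hμ : IsGibbsMeasure (ymSpecification (d := d) ρ β) μ)
    {n : ℕ} (Λ : Fin n → Finset (ZdEdge d)) (A : Fin n → LGConfig d G → ℝ) (hAc : ∀ i, Continuous (A i))
    {CA : ℝ} (hAb : ∀ i U, |A i U| ≤ CA) (hAS : ∀ i, IsCylinder (A i) (Λ i))
    (hfar : ∀ i j : Fin n, i ≠ j →
      Disjoint (Λ j ∪ (plaquettesTouching (Λ j)).biUnion plaquetteEdges) (Λ i))
    {c : Fin n → ℝ} {ε : ℝ} (hker : ∀ (i : Fin n) (η : LGConfig d G), |∫ U, A i U ∂(ymSpecification ρ β (Λ i) η) - c i| ≤ ε) :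
    |∫ U, ∏ i, (A i U - ∫ V, A i V ∂μ) ∂μ| ≤ (2 * ε) ^ n := by
  classical
  haveI := hμ.isProbabilityMeasure
  have hγ : IsSpecification (ymSpecification (d := d) ρ β) := isSpecification_ymSpecification_of_t2Space ρ hρ β
  have hAm : ∀ i, Measurable (A i) := fun i => (hAc i).measurable
  -- the state means `m i` and the conditioned factors `h i`
  set m : Fin n → ℝ := fun i => ∫ V, A i V ∂μ with hm
  set h : Fin n → LGConfig d G → ℝ := fun i η => (∫ U, A i U ∂(ymSpecification ρ β (Λ i) η)) - m i with hh
  have hγprob : ∀ i η, IsProbabilityMeasure (ymSpecification ρ β (Λ i) η) := fun i η =>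
    isProbabilityMeasure_ymSpecification ρ hρ β (Λ i) η
  -- `|m i - c i| ≤ ε` by the DLR equation
  have hmc : ∀ i, |m i - c i| ≤ ε := by
    intro i
    have e : m i = ∫ η, ∫ U, A i U ∂(ymSpecification ρ β (Λ i) η) ∂μ :=
      (hμ.integral_integral_eq hγ (Λ i) (integrable_of_abs_le (hAm i) (hAb i))).symm
    have hkc : Continuous fun η => ∫ U, A i U ∂(ymSpecification ρ β (Λ i) η) :=
      continuous_integral_ymSpecification ρ hρ β (Λ i) (hAc i) (hAb i)
    rw [e, ← integral_sub_const_of_abs_le hkc.measurable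
      (fun η => abs_integral_ymSpecification_le ρ hρ β (Λ i) (hAb i) η) (c i)]
    exact abs_integral_le_of_abs_le fun η => hker i η
  -- properties of `h i`: bounded by `2ε`, continuous, cylinder on `Λ i ∪ ∂Λ i`
  have hhb : ∀ i η, |h i η| ≤ 2 * ε := by
    intro i η
    have h1 := hker i η
    have h2 := hmc i
    calc |h i η| = |(∫ U, A i U ∂(ymSpecification ρ β (Λ i) η) - c i) - (m i - c i)| := by
          simp only [hh]; ring_nf
      _ ≤ |∫ U, A i U ∂(ymSpecification ρ β (Λ i) η) - c i| + |m i - c i| := abs_sub _ _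
      _ ≤ ε + ε := add_le_add h1 h2
      _ = 2 * ε := by ring
  have hhc : ∀ i, Continuous (h i) := fun i =>
    (continuous_integral_ymSpecification ρ hρ β (Λ i) (hAc i) (hAb i)).sub continuous_const
  have hhm : ∀ i, Measurable (h i) := fun i => (hhc i).measurable
  have hhS : ∀ i, IsCylinder (h i) (Λ i ∪ (plaquettesTouching (Λ i)).biUnion plaquetteEdges) := by
    intro i U V hUV
    simp only [hh]
    exact congrArg (fun t : ℝ => t - m i) (dependsOn_integral_ymSpecification ρ hρ β (Λ i) (hAm i) (hAS i) hUV)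
  -- the centred factors
  have hCA0 : ∀ i : Fin n, 0 ≤ CA := fun i => (abs_nonneg _).trans (hAb i (fun _ => 1))
  have hmb : ∀ i, |m i| ≤ CA := fun i => abs_integral_le_of_abs_le (hAb i)
  have hAmb : ∀ i U, |A i U - m i| ≤ 2 * CA := fun i U =>
    (abs_sub _ _).trans (by linarith [hAb i U, hmb i])
  -- the hybrid integrands
  let fac : ℕ → Fin n → LGConfig d G → ℝ := fun k i U => if (i : ℕ) < k then h i U else (A i U - m i)
  have hfacm : ∀ k i, Measurable (fac k i) := by
    intro k i
    by_cases hik : (i : ℕ) < k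
    · simp only [fac, hik, if_true]; exact hhm i
    · simp only [fac, hik, if_false]; exact (hAm i).sub measurable_const
  have hfacb : ∀ k i U, |fac k i U| ≤ 2 * ε + 2 * CA := by
    intro k i U
    have hε0 : 0 ≤ 2 * ε := (abs_nonneg _).trans (hhb i U)
    by_cases hik : (i : ℕ) < k
    · simp only [fac, hik, if_true]; linarith [hhb i U, hCA0 i]
    · simp only [fac, hik, if_false]; linarith [hAmb i U]
  have hfacS : ∀ k i, DependsOn (fac k i)
      (↑(Λ i ∪ (plaquettesTouching (Λ i)).biUnion plaquetteEdges) : Set (ZdEdge d)) := by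
    intro k i U V hUV
    by_cases hik : (i : ℕ) < k
    · simp only [fac, hik, if_true]; exact hhS i hUV
    · simp only [fac, hik, if_false]
      rw [hAS i fun e he => hUV e (by rw [Finset.coe_union]; exact Or.inl he)]
  -- one step: replacing the `k`-th centred factor by `h k` does not change the integral
  have hstep : ∀ k : ℕ, ∀ hk : k < n,
      ∫ U, ∏ i, fac k i U ∂μ = ∫ U, ∏ i, fac (k + 1) i U ∂μ := by
    intro k hk
    set k' : Fin n := ⟨k, hk⟩ with hk'
    -- the common far factor
    set H : LGConfig d G → ℝ := fun U => ∏ i ∈ univ.erase k', fac k i U with hH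
    have hHeq : ∀ U, ∏ i ∈ univ.erase k', fac (k + 1) i U = H U := by
      intro U
      refine Finset.prod_congr rfl fun i hi => ?_
      have hne : (i : ℕ) ≠ k := fun e => (Finset.mem_erase.1 hi).1 (Fin.ext e)
      by_cases hik : (i : ℕ) < k
      · have : (i : ℕ) < k + 1 := by omega
        simp only [fac, hik, this, if_true]
      · have : ¬ (i : ℕ) < k + 1 := by omega
        simp only [fac, hik, this, if_false]
    have hsplit : ∀ (j : ℕ) (U : LGConfig d G), ∏ i, fac j i U = fac j k' U * ∏ i ∈ univ.erase k', fac j i U :=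
      fun j U => (Finset.mul_prod_erase univ (fun i => fac j i U) (Finset.mem_univ k')).symm
    have hk0 : fac k k' = fun U => A k' U - m k' := by
      funext U; simp only [fac, hk', lt_irrefl, if_false]
    have hk1 : fac (k + 1) k' = h k' := by
      funext U; simp only [fac, hk', Nat.lt_succ_self, if_true]
    have hHm : Measurable H := Finset.measurable_prod _ fun i _ => hfacm k i
    have hHb : ∀ U, |H U| ≤ (2 * ε + 2 * CA) ^ (univ.erase k').card := fun U =>
      abs_prod_le_pow _ (fun i _ V => hfacb k i V) U
    have hHdep : DependsOn H ((↑(Λ k') : Set (ZdEdge d))ᶜ) := by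
      refine dependsOn_finset_prod _ fun i hi => (hfacS k i).mono ?_
      have hne : k' ≠ i := fun e => (Finset.mem_erase.1 hi).1 e.symm
      have hd := hfar k' i hne
      intro e he heΛ
      exact Finset.disjoint_left.1 hd (Finset.mem_coe.1 he) heΛ
    calc ∫ U, ∏ i, fac k i U ∂μ = ∫ U, (A k' U - m k') * H U ∂μ := by
          refine integral_congr_ae (ae_of_all _ fun U => ?_)
          change ∏ i, fac k i U = _
          rw [hsplit k U, hk0]
      _ = ∫ η, (∫ U, (A k' U - m k') ∂(ymSpecification ρ β (Λ k') η)) * H η ∂μ :=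
          integral_mul_eq_integral_kernelMean_mul ρ hρ hγ hμ (Λ k') ((hAm k').sub measurable_const)
            (hAmb k') hHm hHb hHdep
      _ = ∫ η, h k' η * H η ∂μ := by
          refine integral_congr_ae (ae_of_all _ fun η => ?_)
          change (∫ U, (A k' U - m k') ∂(ymSpecification ρ β (Λ k') η)) * H η = h k' η * H η
          rw [integral_sub_const_of_abs_le (hAm k') (hAb k') (m k')]
      _ = ∫ U, ∏ i, fac (k + 1) i U ∂μ := by
          refine integral_congr_ae (ae_of_all _ fun U => ?_)
          change h k' U * H U = ∏ i, fac (k + 1) i U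
          rw [hsplit (k + 1) U, hk1, hHeq U]
  -- iterate
  have hiter : ∀ k : ℕ, k ≤ n → ∫ U, ∏ i, fac 0 i U ∂μ = ∫ U, ∏ i, fac k i U ∂μ := by
    intro k
    induction k with
    | zero => intro; rfl
    | succ k ih => intro hk; rw [ih (Nat.le_of_succ_le hk), hstep k hk]
  have h0 : ∀ U, ∏ i, fac 0 i U = ∏ i, (A i U - m i) := fun U =>
    Finset.prod_congr rfl fun i _ => by simp only [fac, Nat.not_lt_zero, if_false]
  have hn : ∀ U, ∏ i, fac n i U = ∏ i, h i U := fun U =>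
    Finset.prod_congr rfl fun i _ => by simp only [fac, i.isLt, if_true]
  have key : ∫ U, ∏ i, (A i U - m i) ∂μ = ∫ U, ∏ i, h i U ∂μ := by
    have := hiter n le_rfl
    simp only [h0, hn] at this
    exact this
  change |∫ U, ∏ i, (A i U - m i) ∂μ| ≤ (2 * ε) ^ n
  rw [key]
  have := abs_integral_le_of_abs_le (μ := μ) (f := fun U => ∏ i, h i U) (C := (2 * ε) ^ (univ : Finset (Fin n)).card)
    fun U => abs_prod_le_pow _ (fun i _ V => hhb i V) U
  simpa using this

end Collar

/-! ## §4 The cubes around separated sites of `ℤ⁴` are far; `FBL6` ⇒ the DLR ceilings -/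

section Application

variable {G : Type} [Group G] [TopologicalSpace G] [IsTopologicalGroup G] [CompactSpace G]
  [MeasurableSpace G] [BorelSpace G] (r : LatticeRep G)

/-- **Separated cubes are far.**  If `2R+4 ≤ |x k − x' k|` for some coordinate `k`, then the links of the radius-`R+1`
cube around `x'` and of the plaquettes touching it (all based within sup-distance `R+2` of `x'`) avoid the radius-`R+1`
cube around `x` (links based within `R+1` of `x`). [folklore] -/
theorem cubeEdges_far {R : ℕ} {x x' : Fin 4 → ℤ} (hsep : ∃ k : Fin 4, (2 * (R : ℤ) + 4) ≤ |x k - x' k|) :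
    Disjoint (cubeEdges (fun k => x' k - (R + 1)) (2 * R + 3) ∪
        (plaquettesTouching (cubeEdges (fun k => x' k - (R + 1)) (2 * R + 3))).biUnion plaquetteEdges)
      (cubeEdges (fun k => x k - (R + 1)) (2 * R + 3)) := by
  obtain ⟨k, hk⟩ := hsep
  refine Finset.disjoint_left.2 fun e he he' => ?_
  have h1 : |e.1 k - x' k| ≤ (R : ℤ) + 2 := by
    rcases Finset.mem_union.1 he with h | h
    · exact (near_of_mem_cubeSites_centred (fst_mem_cubeSites_of_mem_cubeEdges h) k).trans (by linarith)
    · exact near_of_mem_boundary_centred h k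
  have h2 : |e.1 k - x k| ≤ (R : ℤ) + 1 :=
    near_of_mem_cubeSites_centred (fst_mem_cubeSites_of_mem_cubeEdges he') k
  have h3 : |x k - x' k| ≤ |x k - e.1 k| + |e.1 k - x' k| := abs_sub_le _ _ _
  rw [abs_sub_comm (x k) (e.1 k)] at h3
  linarith

/-- **`FBL6` ⟹ THE E0′ CEILINGS FOR EVERY DLR STATE.**  For every compact `G` with a faithful representation `r`
and every unit map `a`: the plane-resolved frozen-boundary femto law `FBL6 G r a` (constants `C₁, β₁, ℓ₁`) implies,
with `C = 2C₁`, `β₄ = β₁`, `ℓ₄ = ℓ₁/5`, that for all `β ≥ β₄`, EVERY `μ ∈ ymGibbsMeasures r.ρ β`, every plane string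
`q` (`(q i).1 < (q i).2`) at sites `x` of `ℤ⁴` pairwise `2R+4`-sup-separated in some coordinate, `1 ≤ R`,
`R·a β ≤ ℓ₄`: `|∫ ∏ᵢ (plane qᵢ xᵢ − ∫ plane qᵢ xᵢ dμ) dμ| ≤ (C/R⁴)ⁿ` — verbatim the body of
`InfiniteVolume.MomentBounds6DLR G r a`.  The Gibbs collar §3 on the radius-`R+1` cubes around the sites (femto cubes:
`(2R+3)·a β ≤ ℓ₁`), `FBL6` at their centres (depth `R+2`, tree `abs_kerE_plane_centred_sub_le`). [folklore] -/
theorem dlrCeilings_of_fbl6 {a : ℝ → ℝ} (hFBL : FBL6 G r a) :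
    ∃ (C β₄ ℓ₄ : ℝ), 0 < ℓ₄ ∧ 0 ≤ C ∧ ∀ β : ℝ, β₄ ≤ β → ∀ μ ∈ ymGibbsMeasures (d := 4) r.ρ β,
      ∀ (n : ℕ) (q : Fin n → Fin 4 × Fin 4) (x : Fin n → (Fin 4 → ℤ)) (R : ℕ), (∀ i, (q i).1 < (q i).2) →
        1 ≤ R → (R : ℝ) * a β ≤ ℓ₄ →
        (∀ i j : Fin n, i ≠ j → ∃ k : Fin 4, (2 * (R : ℤ) + 4) ≤ |x i k - x j k|) →
        |∫ U, ∏ i, (plane G r (q i) (x i) U - ∫ V, plane G r (q i) (x i) V ∂μ) ∂μ| ≤ (C / (R : ℝ) ^ 4) ^ n := by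
  obtain ⟨C₁, β₁, ℓ₁, p, hℓ₁, hC₁, hF⟩ := hFBL
  refine ⟨2 * C₁, β₁, ℓ₁ / 5, by positivity, by positivity, ?_⟩
  intro β hβ μ hμ n q x R hq hR hRa hsep
  haveI : SecondCountableTopology G :=
    (r.continuous.isClosedEmbedding r.injective).isEmbedding.secondCountableTopology
  haveI : T2Space G := (r.continuous.isClosedEmbedding r.injective).isEmbedding.t2Space
  have hμ' : IsGibbsMeasure (ymSpecification (d := 4) r.ρ β) μ := hμ
  obtain ⟨CA, hCA⟩ := exists_abs_plane_le (G := G) r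
  -- the cubes of side `2R+3` are femto cubes
  have hb : ((2 * R + 3 : ℕ) : ℝ) * a β ≤ ℓ₁ := by
    rcases le_or_gt 0 (a β) with ha | ha
    · have h5 : ((2 * R + 3 : ℕ) : ℝ) ≤ 5 * R := by
        have : (1 : ℝ) ≤ R := by exact_mod_cast hR
        push_cast
        linarith
      calc ((2 * R + 3 : ℕ) : ℝ) * a β ≤ 5 * R * a β := mul_le_mul_of_nonneg_right h5 ha
        _ = 5 * ((R : ℝ) * a β) := by ring
        _ ≤ 5 * (ℓ₁ / 5) := by gcongr
        _ = ℓ₁ := by ring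
    · have : ((2 * R + 3 : ℕ) : ℝ) * a β ≤ 0 := mul_nonpos_of_nonneg_of_nonpos (by positivity) ha.le
      linarith
  have hker : ∀ (i : Fin n) (η : LGConfig 4 G),
      |(∫ U, plane G r (q i) (x i) U ∂(ymSpecification r.ρ β
        (cubeEdges (fun k => x i k - (R + 1)) (2 * R + 3)) η)) - p (q i) β| ≤ C₁ / (R : ℝ) ^ 4 :=
    fun i η => abs_kerE_plane_centred_sub_le r hC₁ (hF β hβ) (hq i) hR hb (x i) η
  have key := abs_integral_prod_sub_mean_le_of_isGibbsMeasure (d := 4) r.ρ r.continuous hμ'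
    (fun i => cubeEdges (fun k => x i k - (R + 1)) (2 * R + 3)) (fun i => plane G r (q i) (x i))
    (fun i => continuous_plane r (q i) (x i)) (fun i U => hCA (q i) (x i) U)
    (fun i => isCylinder_plane_cube r hR (q i) (x i)) (fun i j hij => cubeEdges_far (hsep i j hij)) hker
  rw [show (2 : ℝ) * C₁ / (R : ℝ) ^ 4 = 2 * (C₁ / (R : ℝ) ^ 4) from mul_div_assoc _ _ _]
  exact key

end Application

end Summit.QuantumFields.YangMills.Theorems.InfiniteVolume

end
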